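import Literature.NumberTheory.EllipticCurves.GlobalMinimalModel
import Literature.NumberTheory.EllipticCurves.RootNumberProofs
import Literature.NumberTheory.EllipticCurves.PAdicHeightsProofs
import Literature.NumberTheory.DiophantineGeometry.EllArithGlueProofs
import Literature.NumberTheory.DiophantineGeometry.MinimalDiscriminantProofs
import Mathlib.NumberTheory.Height.NumberField
import HarnessLib

/-!
# The denominator of the `j`-invariant over `ℚ`: multiplicative primes, the minimal discriminant, the height

Topic `NumberTheory/EllipticCurves` (family `abc`, G06). Three elementary facts about an elliptic
curve `E/ℚ` used in the assembly of Silverman's theorem towards Lang's conjecture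
(`Literature.NumberTheory.EllipticCurves.langHeightLowerBound_of_nu`, AEC Thm. VIII.9.10(a), whose
constant depends on the number `ν(E)` of primes dividing the denominator of `j_E`; file
`LangHeightNuProofs.lean`), all proved here from the tree:

* `natGenerator_dvd_den_j_of_hasSplitMultiplicativeReductionAt` — a prime of (split)
  multiplicative reduction divides `den(j_E)`, i.e. `ord_p(j_E) < 0` (Silverman, AEC VII.5,
  Prop. 5.1(b): multiplicative reduction iff `v(Δ) > 0`, `v(c₄) = 0` for a minimal equation, so
  `|j|_p = |c₄³/Δ|_p > 1`; in the tree `WeierstrassCurve.one_lt_norm_j_of_hasMultiplicativeReductionAtPrime`,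
  transported from `ℚ_[p]` to the place `v` by
  `WeierstrassCurve.hasMultiplicativeReductionAtPrime_primesEquiv_iff_hasMultiplicativeReductionAt`);
* `den_j_dvd_natAbs_minimalDiscriminantInt` — for a globally minimal equation, `den(j) ∣ |Δ_min|`
  (`j = c₄³/Δ` with `c₄ ∈ ℤ`);
* `logHeight₁_j_le` — hence `h(j) ≤ max{1, log|j|} + log N(𝔇_min)` (`h(j) = log max{|num j|, den j}`,
  Mathlib's `Rat.logHeight₁_eq_log_max`).

## Design notes

Pure proofs, no definitions; namespace = path. Places of `ℚ` are `v : HeightOneSpectrum ℤ` with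
`p_v = Rat.HeightOneSpectrum.natGenerator v`, as in `NeronLocalHeight.lean` and `Conductor.lean`.

## References

* J. H. Silverman, *The Arithmetic of Elliptic Curves*, GTM 106, 2nd ed. (2009), VII.1 Prop. 1.3,
  VII.5 Prop. 5.1(b), VIII.8 (minimal discriminant), VIII.9 Thm. 9.10(a).
-/

noncomputable section

open scoped Classical

open IsDedekindDomain

namespace Literature.NumberTheory.EllipticCurves

open Rat.HeightOneSpectrum _root_.WeierstrassCurve

/-! ### Two arithmetic facts about the `j`-invariant over `ℚ` -/

section Rat

variable (W : WeierstrassCurve ℚ) [W.IsElliptic]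

/-- A prime of split multiplicative reduction divides the denominator of `j(E)`: the reduction is
multiplicative, so `|j(E)|_p > 1` (`one_lt_norm_j_of_hasMultiplicativeReductionAtPrime`, AEC
Prop. VII.5.1(b), transported from `ℚ_v` to `ℚ_[p]` by
`hasMultiplicativeReductionAtPrime_primesEquiv_iff_hasMultiplicativeReductionAt`), i.e.
`ord_p(j) < 0`. [folklore] -/
theorem natGenerator_dvd_den_j_of_hasSplitMultiplicativeReductionAt {v : HeightOneSpectrum ℤ}
    (hv : W.HasSplitMultiplicativeReductionAt v) : natGenerator v ∣ (W.j).den := by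
  haveI := Fact.mk (primesEquiv v).2
  have hmult : W.HasMultiplicativeReductionAtPrime (primesEquiv v) :=
    (hasMultiplicativeReductionAtPrime_primesEquiv_iff_hasMultiplicativeReductionAt W v).mpr
      hv.hasMultiplicativeReductionAt
  have hj := one_lt_norm_j_of_hasMultiplicativeReductionAtPrime hmult
  rw [Padic.eq_padicNorm] at hj
  by_contra hnd
  have hden : padicNorm (primesEquiv v : ℕ) ((W.j).den : ℚ) = 1 :=
    (padicNorm.nat_eq_one_iff _).mpr hnd
  have hnum : padicNorm (primesEquiv v : ℕ) ((W.j).num : ℚ) ≤ 1 := padicNorm.of_int _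
  have hq : padicNorm (primesEquiv v : ℕ) W.j ≤ 1 := by
    conv_lhs => rw [← Rat.num_div_den W.j]
    rw [padicNorm.div, hden, div_one]
    exact hnum
  have hq' : (padicNorm (primesEquiv v : ℕ) W.j : ℝ) ≤ 1 := by exact_mod_cast hq
  linarith

/-- For a globally minimal equation over `ℚ`, the denominator of `j = c₄³/Δ` divides the minimal
discriminant (`c₄ ∈ ℤ`). [folklore] -/
theorem den_j_dvd_natAbs_minimalDiscriminantInt [W.IsGloballyMinimal] :
    (W.j).den ∣ (minimalDiscriminantInt W).natAbs := by
  have hj : W.j = W.c₄ ^ 3 / W.Δ := by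
    rw [j, ← coe_Δ', Units.val_inv_eq_inv_val]; ring
  have hc₄ : W.c₄ = ((integralModelInt W).c₄ : ℚ) := by
    conv_lhs => rw [← map_integralModelInt W]
    rw [map_c₄, eq_intCast]
  rw [hj, hc₄, ← cast_minimalDiscriminantInt W]
  have h := Rat.den_dvd ((integralModelInt W).c₄ ^ 3) (minimalDiscriminantInt W)
  rw [Rat.divInt_eq_div] at h
  push_cast at h
  exact Int.natCast_dvd.mp h

/-- `h(j) ≤ max{1, log|j|} + log N(𝔇_min)` over `ℚ` for a globally minimal equation:
`h(j) = log max{|num j|, den j}`, `|num j| = |j| · den j` and `den j ∣ |Δ_min| = N(𝔇_min)`.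
[folklore] -/
theorem logHeight₁_j_le [W.IsGloballyMinimal] :
    Height.logHeight₁ W.j ≤
      max 1 (Real.log |((W.j : ℚ) : ℝ)|) + Real.log (W.minimalDiscriminantNorm ℤ : ℝ) := by
  have hD : W.minimalDiscriminantNorm ℤ = (minimalDiscriminantInt W).natAbs :=
    minimalDiscriminantNorm_int_eq_natAbs_minimalDiscriminantInt_holds W
  have hDpos : 0 < W.minimalDiscriminantNorm ℤ := minimalDiscriminantNorm_pos_holds W
  have hden : (W.j).den ∣ W.minimalDiscriminantNorm ℤ := hD ▸ den_j_dvd_natAbs_minimalDiscriminantInt W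
  have hdenle : ((W.j).den : ℝ) ≤ (W.minimalDiscriminantNorm ℤ : ℝ) := by
    exact_mod_cast Nat.le_of_dvd hDpos hden
  have hden0 : (0 : ℝ) < (W.j).den := by exact_mod_cast (W.j).den_pos
  have hlogD : Real.log ((W.j).den : ℝ) ≤ Real.log (W.minimalDiscriminantNorm ℤ : ℝ) :=
    Real.log_le_log hden0 hdenle
  have hlogD0 : 0 ≤ Real.log ((W.j).den : ℝ) := Real.log_nonneg (by exact_mod_cast (W.j).den_pos)
  rw [Rat.logHeight₁_eq_log_max]
  -- `|j| = |num| / den` as real numbers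
  have habs : |((W.j : ℚ) : ℝ)| = ((W.j).num.natAbs : ℝ) / ((W.j).den : ℝ) := by
    rw [Rat.cast_def, abs_div, Nat.cast_natAbs, Int.cast_abs, Nat.abs_cast]
  rcases le_or_gt (W.j).num.natAbs (W.j).den with hle | hlt
  · rw [max_eq_right hle]
    linarith [le_max_left 1 (Real.log |((W.j : ℚ) : ℝ)|)]
  · rw [max_eq_left hlt.le]
    have hnum0 : (0 : ℝ) < ((W.j).num.natAbs : ℝ) := by
      exact_mod_cast lt_of_le_of_lt (Nat.zero_le _) hlt
    have hlog : Real.log ((W.j).num.natAbs : ℝ) =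
        Real.log |((W.j : ℚ) : ℝ)| + Real.log ((W.j).den : ℝ) := by
      rw [habs, Real.log_div hnum0.ne' hden0.ne']
      ring
    push_cast [Nat.cast_natAbs] at hlog ⊢
    rw [hlog]
    linarith [le_max_right 1 (Real.log |((W.j : ℚ) : ℝ)|), hlogD]

end Rat


end Literature.NumberTheory.EllipticCurves

end
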